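import Mathlib
import HarnessLib
import Summits.Ventures.LatticeQCDFlow.Scaling.IdentityFlowStrongCoupling
import Summits.Ventures.LatticeQCDFlow.Scaling.U1IdentityFlowKL
import Summits.Ventures.LatticeQCDFlow.Scaling.U1IdentityFlowWeakCouplingExponent
import Summits.Ventures.LatticeQCDFlow.Scaling.CumulantDiagonalLimit
import Summits.Ventures.LatticeQCDFlow.Scaling.SU2IdentityFlowSlopeVolumeSandwich
import Summits.Ventures.LatticeQCDFlow.Scoring.OnePlaquetteBessel

/-!
# LatticeQCDFlow / Scaling — PLAQUETTE LOSS LAWS on the diagonal: U(1) `V·log I₀(c/√V) → c²/4`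
# (`cgf_cos = log I₀`, `cgf_cos′ = I₁/I₀`) and SU(2) `V·log((2/π)Z₂(c/√V)) → c²/8`

HONEST FRAMING: exact (Metropolis-corrected) sampling algorithms for lattice gauge theory;
figures of merit are autocorrelation/cost numbers at stated couplings and volumes; no
continuum-physics claim.

Venture `LatticeQCDFlow` (cell pub-lqcd), topic `Scaling`; FANOUT row 3 (`s0-u1-a`, S0-B
implementation A, GEN-20).  NEW WORK of the cell — the U(1) instance of the GEN-20 loss laws, assembled
on row 3's GEN-16 `Scaling/IdentityFlowStrongCoupling` (`I₀(β)` is the moment generating function of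
`cos` under the uniform law on `(0, 2π]`, `Var cos = ½`), GEN-12 `Scaling/U1IdentityFlowKL` (the reverse
divergence of the identity flow on `V` independent plaquettes is `V·log I₀(β)` EXACTLY), GEN-16
`Scaling/U1IdentityFlowWeakCouplingExponent` (`(log I₀)′ = I₁/I₀`) and GEN-19 `Scaling/CumulantDiagonalLimit`
(`n·cgf(c/√n) → c²σ²/2`); for SU(2): GEN-18 `Scaling/SU2IdentityFlowSlopeVolumeSandwich` (the class-angle
law `ν₂ = (2/π)sin²α dα` on `(0, π]`, `E cos = 0`, `E cos² = ¼`) and row 5's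
`Scoring/OnePlaquetteBessel` (`β·Z₂(β) = π I₁(β)`); NO definition is introduced; nothing is cited.

## Content (all `[ours]`)

* `cgf_cos_uniform_eq_log_besselI` — `cgf_{cos}(β) = log I₀(β)` under the uniform law;
  `deriv_cgf_cos_uniform` — `cgf_{cos}′(β) = I₁(β)/I₀(β)` (the mean plaquette of the tilt);
* **`tendsto_nat_mul_log_besselI_div_sqrt`** — `n·log I₀(c/√n) → c²/4` for every real `c`;
* **`u1IdentityFlow_reverseKL_diag_tendsto`** — in GEN-12's vocabulary: the reverse training loss of
  the untrained U(1) sampler on `n` independent plaquettes at `β = c/√n` converges to `c²/4`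
  (`= s/2` with `s = c²σ²`, `σ² = ½`; `Scaling/U1IdentityFlowDiagonalLimit`: acceptance
  `→ erfc(|c|/(2√2)) = erfc(√(D/2))` with `D = c²/4`);
* SU(2), class angle: `mgf_cos_su2ClassOne` (`M(β) = (2/π)Z₂(β)`), `cgf_cos_su2ClassOne`
  (`= log((2/π)Z₂(β))`, `= log(2I₁(β)/β)` for `β > 0`: `cgf_cos_su2ClassOne_eq_log_besselI`),
  **`tendsto_nat_mul_cgf_cos_su2_div_sqrt`** — the reverse training loss of the untrained factorised
  SU(2) sampler at `β = c/√n`, `n·log((2/π)Z₂(c/√n)) → c²/8` (`σ² = ¼`; `Scaling/IdentityFlowSlopeVolumeLimit`: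
  acceptance `→ erfc(|c|/4) = erfc(√(D/2))` with `D = c²/8`).

Reading (value-free): for the cell's 2D U(1) target with independent plaquettes the untrained
sampler's training loss is `Vβ²/4` to leading order and stays bounded exactly on couplings
`β = O(V^{−1/2})`, where it equals `c²/4`.
NOT CLAIMED: the torus (one global constraint); SU(3); the forward loss and the ESS on the
diagonal in this vocabulary (`Scaling/U1IdentityFlowDiagonalLimit`, staged); any value at the cell's
`(β, L)`; nothing re-scored.
-/

noncomputable section

namespace Summit.Ventures.LatticeQCDFlow.Theory2

open MeasureTheory Real Set Filter Topology ProbabilityTheory Finset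
open Literature.Analysis.FunctionSpaces (besselI besselI_zero_pos hasDerivAt_besselI_zero)
open Summit.Ventures.LatticeQCDFlow.Scoring (onePlaquetteZ onePlaquetteZ_pos onePlaquetteZ_eq_besselI
  onePlaquetteZSU2 onePlaquetteZSU2_pos beta_mul_onePlaquetteZSU2)

section U1Loss

/-- **`cgf_{cos}(β) = log I₀(β)`** under the uniform probability law on `(0, 2π]`. [ours] -/
theorem cgf_cos_uniform_eq_log_besselI (β : ℝ) :
    cgf (fun θ => Real.cos θ) ((ENNReal.ofReal (2 * π))⁻¹ • volume.restrict (Ioc (0 : ℝ) (2 * π))) β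
      = Real.log (besselI 0 β) := by
  rw [cgf, ← besselI_zero_eq_mgf_uniform]

/-- **`cgf_{cos}′(β) = I₁(β)/I₀(β)`** — the mean plaquette `⟨cos θ⟩_β` of the one-plaquette tilt.
[ours] -/
theorem deriv_cgf_cos_uniform (β : ℝ) :
    deriv (cgf (fun θ => Real.cos θ) ((ENNReal.ofReal (2 * π))⁻¹ • volume.restrict (Ioc (0 : ℝ) (2 * π)))) β
      = besselI 1 β / besselI 0 β := by
  have h : cgf (fun θ => Real.cos θ) ((ENNReal.ofReal (2 * π))⁻¹ • volume.restrict (Ioc (0 : ℝ) (2 * π)))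
      = fun x => Real.log (besselI 0 x) := funext fun x => cgf_cos_uniform_eq_log_besselI x
  rw [h]
  exact (hasDerivAt_log_besselI_zero β).deriv

/-- **`n·log I₀(c/√n) → c²/4`** for every real `c` (`cgf_{cos}` on the diagonal; `Var cos = ½`). [ours] -/
theorem tendsto_nat_mul_log_besselI_div_sqrt (c : ℝ) :
    Tendsto (fun n : ℕ => (n : ℝ) * Real.log (besselI 0 (c / Real.sqrt n))) atTop (𝓝 (c ^ 2 / 4)) := by
  haveI := isProbabilityMeasure_uniform_Ioc
  set U : Measure ℝ := (ENNReal.ofReal (2 * π))⁻¹ • volume.restrict (Ioc (0 : ℝ) (2 * π)) with hU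
  have hm : AEMeasurable (fun θ => Real.cos θ) U := Real.continuous_cos.aemeasurable
  have hb : ∀ᵐ θ ∂U, Real.cos θ ∈ Set.Icc (-1 : ℝ) 1 :=
    ae_of_all _ fun θ => ⟨Real.neg_one_le_cos θ, Real.cos_le_one θ⟩
  have hπ : (0 : ℝ) ≤ 2 * π := by positivity
  have h0 : ∫ θ, Real.cos θ ∂U = 0 := by
    rw [hU, integral_smul_measure, ← intervalIntegral.integral_of_le hπ, integral_cos]
    simp
  have h := tendsto_nat_mul_cgf_div_sqrt hm hb h0 c
  rw [variance_cos_uniform] at h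
  have e : c ^ 2 * (1 / 2) / 2 = c ^ 2 / 4 := by ring
  rw [e] at h
  refine h.congr fun n => ?_
  rw [cgf_cos_uniform_eq_log_besselI]

/-- **THE U(1) TRAINING LOSS ON THE DIAGONAL** (GEN-12 vocabulary): the reverse divergence of the
identity flow on `n` independent plaquettes — Lebesgue densities `(2π)^{−n}` (Haar) against
`∏ e^{β cos θᵢ}/Z(β)` — at `β = c/√n` converges to `c²/4`. [ours] -/
theorem u1IdentityFlow_reverseKL_diag_tendsto (c : ℝ) :
    Tendsto (fun n : ℕ =>
      ∫ x, (∏ _i : Fin n, (1 / (2 * π) : ℝ)) * Real.log ((∏ _i : Fin n, (1 / (2 * π) : ℝ))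
          / ∏ i : Fin n, Real.exp (c / Real.sqrt n * Real.cos (x i)) / onePlaquetteZ (c / Real.sqrt n))
          ∂(Measure.pi fun _ : Fin n => volume.restrict (Ioc (0 : ℝ) (2 * π)))) atTop
      (𝓝 (c ^ 2 / 4)) := by
  refine (tendsto_nat_mul_log_besselI_div_sqrt c).congr fun n => ?_
  rw [u1IdentityFlow_reverseKL (ι := Fin n) (c / Real.sqrt n), Fintype.card_fin]

end U1Loss

/-! ## SU(2): the class-angle law `ν₂ = (2/π) sin²α dα` on `(0, π]` -/

section SU2Loss

/-- **`M_{cos}(β) = (2/π)·Z₂(β)`** under the SU(2) class-angle law. [ours] -/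
theorem mgf_cos_su2ClassOne (β : ℝ) :
    mgf (fun α => Real.cos α) ((volume.restrict (Ioc (0 : ℝ) π)).withDensity
        fun α => ENNReal.ofReal (2 / π * Real.sin α ^ 2)) β
      = 2 / π * onePlaquetteZSU2 β := by
  rw [mgf, integral_su2ClassOne, onePlaquetteZSU2, ← intervalIntegral.integral_const_mul]
  refine intervalIntegral.integral_congr fun α _ => ?_
  ring

/-- **`cgf_{cos}(β) = log((2/π)·Z₂(β))`** under the SU(2) class-angle law. [ours] -/
theorem cgf_cos_su2ClassOne (β : ℝ) :
    cgf (fun α => Real.cos α) ((volume.restrict (Ioc (0 : ℝ) π)).withDensity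
        fun α => ENNReal.ofReal (2 / π * Real.sin α ^ 2)) β
      = Real.log (2 / π * onePlaquetteZSU2 β) := by
  rw [cgf, mgf_cos_su2ClassOne]

/-- Bessel form for `β > 0`: `cgf_{cos}(β) = log(2·I₁(β)/β)`. [ours] -/
theorem cgf_cos_su2ClassOne_eq_log_besselI {β : ℝ} (hβ : 0 < β) :
    cgf (fun α => Real.cos α) ((volume.restrict (Ioc (0 : ℝ) π)).withDensity
        fun α => ENNReal.ofReal (2 / π * Real.sin α ^ 2)) β
      = Real.log (2 * besselI 1 β / β) := by
  rw [cgf_cos_su2ClassOne]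
  congr 1
  have h := beta_mul_onePlaquetteZSU2 β
  have hπ : (π : ℝ) ≠ 0 := Real.pi_pos.ne'
  field_simp
  linarith [h]

/-- **THE SU(2) TRAINING LOSS ON THE DIAGONAL**: `n·log((2/π)Z₂(c/√n)) → c²/8` — the reverse training
loss of the untrained factorised SU(2) sampler (`n` independent plaquettes, class-angle chart) at
`β = c/√n` (`Var cos = ¼` under `ν₂`). [ours] -/
theorem tendsto_nat_mul_cgf_cos_su2_div_sqrt (c : ℝ) :
    Tendsto (fun n : ℕ => (n : ℝ) * Real.log (2 / π * onePlaquetteZSU2 (c / Real.sqrt n))) atTop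
      (𝓝 (c ^ 2 / 8)) := by
  haveI := su2ClassOne_isProbabilityMeasure
  set U : Measure ℝ := (volume.restrict (Ioc (0 : ℝ) π)).withDensity
      fun α => ENNReal.ofReal (2 / π * Real.sin α ^ 2) with hU
  have hm : AEMeasurable (fun α => Real.cos α) U := Real.continuous_cos.aemeasurable
  have hb : ∀ᵐ α ∂U, Real.cos α ∈ Set.Icc (-1 : ℝ) 1 :=
    ae_of_all _ fun α => ⟨Real.neg_one_le_cos α, Real.cos_le_one α⟩
  obtain ⟨h0, h2, -⟩ := cos_su2ClassOne_moments
  have hvar : Var[fun α => Real.cos α; U] = 1 / 4 := by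
    rw [variance_of_integral_eq_zero hm h0]
    exact h2
  have h := tendsto_nat_mul_cgf_div_sqrt hm hb h0 c
  rw [hvar] at h
  have e : c ^ 2 * (1 / 4) / 2 = c ^ 2 / 8 := by ring
  rw [e] at h
  refine h.congr fun n => ?_
  rw [cgf_cos_su2ClassOne]

end SU2Loss

end Summit.Ventures.LatticeQCDFlow.Theory2

end
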